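import Literature.Geometry.Riemannian.GradientShrinkerProofs
import Literature.Geometry.Riemannian.PerelmanMuLowerBound
import Summits.SmoothPoincare4.SmoothPoincare4.Theorems.EntropyRungSubcylindricalExistenceEntropyLocalisation
import HarnessLib

/-!
# The Yamabe–Sobolev inequality of a conformal class with positively invertible conformal Laplacian
(stub `stub_yamabeSobolevOfNonneg`, S4 of line `green-blowup-conformal-entropy`, crux
`EntropyRung.SubcylindricalExistence`, item stmt-SmoothPoincare4-10871)

On a closed smooth `4`-manifold `M` of the summit binder let `g` be a smooth Riemannian metric
(Levi-Civita connection) whose conformal Laplacian `L_g = R_g − 6 Δ_g` has a positive smooth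
"ground state" `u₀ > 0` with `L_g u₀ = 1` (this is the situation of Schoen's flat gauge: `R_g ≥ 0`
only, but `L_g` positively invertible). We prove: there is `Y > 0` such that for every smooth
`ψ > 0` and every smooth `u`,
`Y (∫ u⁴ ψ⁴ dV_g)^{1/2} ≤ ∫ (6 ψ² |∇u|²_g + ψ (R_g ψ − 6 Δ_g ψ) u²) dV_g`.

Proof (the covariance trick, carried out on the level of the quadratic form, without realising
the metric `u₀² g`): by the conformal invariance of the Yamabe energy
(`integral_conformal_eq`, Lee–Parker 1987, §3) the right-hand side equals
`E(ψu) := ∫ (6|∇(ψu)|² + R (ψu)²) dV_g`, and, writing `ψ u = u₀ w`, the same identity read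
backwards with `L_g u₀ = 1` gives `E(u₀ w) = ∫ (6 u₀² |∇w|² + u₀ w²) dV_g`. With
`0 < c ≤ u₀ ≤ C` (compactness) this is `≥ 6c² ∫|∇w|² + c ∫ w²`, while the left-hand side is
`(∫ u₀⁴ w⁴)^{1/2} ≤ C² (∫ w⁴)^{1/2} ≤ C² (A ∫|∇w|² + B ∫ w²)` by the squared Sobolev inequality
of the closed manifold (`exists_sobolev_sq`, Hebey 1999, Thm. 2.6). The two ingredients
`integral_conformal_eq` and `exists_sobolev_sq` are private copies of the lemmas of the same name of
helper H10 (`EntropyRungSubcylindricalExistenceYamabeSobolev.lean`, namespace `YamabeSobolev`), kept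
here so that this file only depends on H10's imports. Everything is proved; no definition, no named
fact. References: Lee–Parker 1987, §3; Hebey 1999, Thm. 2.6; Lee 2018, Problem 2-23; Schoen 1984,
§1 (the gauge `L_g u₀ = 1`).
-/

noncomputable section

-- the registered namespace `Summit.SmoothPoincare4.SmoothPoincare4.Theorems` repeats a component
set_option linter.dupNamespace false

open scoped Manifold ContDiff Topology ENNReal NNReal
open Set Filter MeasureTheory
open Literature.Geometry.Lorentzian Literature.Geometry.Riemannian

namespace Summit.SmoothPoincare4.SmoothPoincare4.Theorems

namespace YamabeSobolevOfNonneg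

/-- A positive continuous function on a compact space is pinched between two positive constants.
[folklore] -/
theorem exists_pos_bounds {X : Type*} [TopologicalSpace X] [CompactSpace X] {φ : X → ℝ}
    (hφc : Continuous φ) (hφ : ∀ x, 0 < φ x) :
    ∃ c C : ℝ, 0 < c ∧ 0 < C ∧ ∀ x, c ≤ φ x ∧ φ x ≤ C := by
  rcases isEmpty_or_nonempty X with hX | hX
  · exact ⟨1, 1, one_pos, one_pos, fun x ↦ hX.elim x⟩
  · obtain ⟨x₀, -, hx₀⟩ := isCompact_univ.exists_isMinOn univ_nonempty hφc.continuousOn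
    obtain ⟨x₁, -, hx₁⟩ := isCompact_univ.exists_isMaxOn univ_nonempty hφc.continuousOn
    exact ⟨φ x₀, φ x₁, hφ x₀, hφ x₁, fun x ↦
      ⟨(isMinOn_iff.1 hx₀) x (mem_univ x), (isMaxOn_iff.1 hx₁) x (mem_univ x)⟩⟩

/-- The bookkeeping of the assembly: if `k ≤ c`, `k ≤ 6c²`, `S ≤ C² (A X + B V)` and
`6c² X + c V ≤ R` (all quantities nonnegative) then `k / (C²(A + B) + 1) · S ≤ R`. [folklore] -/
theorem assembly_arith {k c C A B X V S R : ℝ} (hkc : k ≤ c) (hk6 : k ≤ 6 * c ^ 2) (hk : 0 ≤ k)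
    (hA : 0 ≤ A) (hB : 0 ≤ B) (hX : 0 ≤ X) (hV : 0 ≤ V)
    (hS : S ≤ C ^ 2 * (A * X + B * V)) (hR : 6 * c ^ 2 * X + c * V ≤ R) :
    k / (C ^ 2 * (A + B) + 1) * S ≤ R := by
  have hD : 0 < C ^ 2 * (A + B) + 1 := by positivity
  have h1 : S ≤ (C ^ 2 * (A + B) + 1) * (X + V) := by
    nlinarith [mul_nonneg (mul_nonneg (sq_nonneg C) hA) hV,
      mul_nonneg (mul_nonneg (sq_nonneg C) hB) hX]
  have h2 : k * (X + V) ≤ R := by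
    nlinarith [mul_le_mul_of_nonneg_right hkc hV, mul_le_mul_of_nonneg_right hk6 hX]
  calc k / (C ^ 2 * (A + B) + 1) * S
      ≤ k / (C ^ 2 * (A + B) + 1) * ((C ^ 2 * (A + B) + 1) * (X + V)) :=
        mul_le_mul_of_nonneg_left h1 (div_nonneg hk hD.le)
    _ = k * (X + V) := by rw [← mul_assoc, div_mul_cancel₀ _ hD.ne']
    _ ≤ R := h2

variable {M : Type} [TopologicalSpace M]
  [ChartedSpace (EuclideanSpace ℝ (Fin 4)) M] [IsManifold (𝓡 4) ∞ M]
  (g : PseudoRiemannianMetric (𝓡 4) ∞ (EuclideanSpace ℝ (Fin 4)) (TangentSpace (𝓡 4) : M → Type _))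

/-! ### The two ingredients of helper H10 (private copies)

Adapted verbatim from `Summits/SmoothPoincare4/SmoothPoincare4/Theorems/
EntropyRungSubcylindricalExistenceYamabeSobolev.lean`, namespace `YamabeSobolev`. -/

/-- `g⁻¹(d(u²ψ), dψ) = u² |∇ψ|² + 2 u ψ g⁻¹(du, dψ)` (product rule and bilinearity). -/
private theorem innerDual_dcov_sq_mul {u ψ : M → ℝ} {x : M} (hu : MDifferentiableAt (𝓡 4) 𝓘(ℝ, ℝ) u x)
    (hψ : MDifferentiableAt (𝓡 4) 𝓘(ℝ, ℝ) ψ x) :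
    g.innerDual x (mvfderiv (𝓡 4) (fun y ↦ u y * u y * ψ y) x : TangentSpace (𝓡 4) x →ₗ[ℝ] ℝ)
        (mvfderiv (𝓡 4) ψ x : TangentSpace (𝓡 4) x →ₗ[ℝ] ℝ) =
      u x ^ 2 * g.gradSq ψ x + 2 * (u x * ψ x) *
        g.innerDual x (mvfderiv (𝓡 4) u x : TangentSpace (𝓡 4) x →ₗ[ℝ] ℝ)
          (mvfderiv (𝓡 4) ψ x : TangentSpace (𝓡 4) x →ₗ[ℝ] ℝ) := by
  have huu : MDifferentiableAt (𝓡 4) 𝓘(ℝ, ℝ) (fun y ↦ u y * u y) x := hu.mul hu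
  rw [EntropyLocalisation.dcov_mul huu hψ, EntropyLocalisation.dcov_mul hu hu]
  simp only [g.innerDual_add_left, g.innerDual_smul_left, PseudoRiemannianMetric.gradSq]
  ring

variable [T2Space M] [CompactSpace M] [T3Space M] [MeasurableSpace M] [BorelSpace M]

/-- **Conformal invariance of the Yamabe energy** (the quadratic form of `L_g = R − 6Δ` in
dimension four): for smooth `ψ, u` on the closed manifold,
`∫ (6 ψ² |∇u|² + ψ (R ψ − 6 Δψ) u²) dV = ∫ (6 |∇(ψu)|² + R (ψu)²) dV`
(`|∇(ψu)|² = ψ²|∇u|² + 2ψu g⁻¹(dψ,du) + u²|∇ψ|²` and Green's identity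
`∫ u²ψ Δψ = −∫ g⁻¹(d(u²ψ), dψ) = −∫ (u²|∇ψ|² + 2uψ g⁻¹(du,dψ))`). Lee–Parker 1987, §3. -/
private theorem integral_conformal_eq [g.HasLeviCivita] (hg : g.IsRiemannian) {ψ u : M → ℝ}
    (hψ : ContMDiff (𝓡 4) 𝓘(ℝ, ℝ) ∞ ψ) (hu : ContMDiff (𝓡 4) 𝓘(ℝ, ℝ) ∞ u) :
    ∫ x, (6 * (ψ x ^ 2 * g.gradSq u x)
        + ψ x * (g.scalarCurvature x * ψ x - 6 * g.dalembertian ψ x) * u x ^ 2) ∂g.riemVolume =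
      ∫ x, (6 * g.gradSq (fun y ↦ ψ y * u y) x + g.scalarCurvature x * (ψ x * u x) ^ 2)
        ∂g.riemVolume := by
  -- regularity
  have hψ1 : ContMDiff (𝓡 4) 𝓘(ℝ, ℝ) 1 ψ := hψ.of_le (by norm_num)
  have hψ2 : ContMDiff (𝓡 4) 𝓘(ℝ, ℝ) 2 ψ := hψ.of_le (WithTop.coe_le_coe.mpr le_top)
  have hF : ContMDiff (𝓡 4) 𝓘(ℝ, ℝ) ∞ (fun y ↦ u y * u y * ψ y) := (hu.mul hu).mul hψ
  have hF1 : ContMDiff (𝓡 4) 𝓘(ℝ, ℝ) 1 (fun y ↦ u y * u y * ψ y) := hF.of_le (by norm_num)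
  have hψc : Continuous ψ := hψ.continuous
  have huc : Continuous u := hu.continuous
  have hRc : Continuous g.scalarCurvature := g.contMDiff_scalarCurvature.continuous
  have hΔc : Continuous (g.dalembertian ψ) := continuous_dalembertian g hψ2
  have hIc := continuous_innerDual_mvfderiv g hF1 hψ1
  have hGc : Continuous (g.gradSq fun y ↦ ψ y * u y) := (contMDiff_gradSq g (hψ.mul hu)).continuous
  have hGu : Continuous (g.gradSq u) := (contMDiff_gradSq g hu).continuous
  -- Green's first identity for `u²ψ` against `ψ`
  have hGreen := integral_mul_dalembertian_riemVolume g hg hF1 hψ2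
  -- the pointwise identity of the integrands
  have hpt : (fun x ↦ 6 * (ψ x ^ 2 * g.gradSq u x)
      + ψ x * (g.scalarCurvature x * ψ x - 6 * g.dalembertian ψ x) * u x ^ 2) =
      fun x ↦ (6 * g.gradSq (fun y ↦ ψ y * u y) x + g.scalarCurvature x * (ψ x * u x) ^ 2)
        - 6 * (g.innerDual x
            (mvfderiv (𝓡 4) (fun y ↦ u y * u y * ψ y) x : TangentSpace (𝓡 4) x →ₗ[ℝ] ℝ)
            (mvfderiv (𝓡 4) ψ x : TangentSpace (𝓡 4) x →ₗ[ℝ] ℝ)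
          + u x * u x * ψ x * g.dalembertian ψ x) := by
    funext x
    have hux : MDifferentiableAt (𝓡 4) 𝓘(ℝ, ℝ) u x := (hu x).mdifferentiableAt (by simp)
    have hψx : MDifferentiableAt (𝓡 4) 𝓘(ℝ, ℝ) ψ x := (hψ x).mdifferentiableAt (by simp)
    rw [EntropyLocalisation.gradSq_mul g hψx hux, innerDual_dcov_sq_mul g hux hψx,
      g.innerDual_comm x (mvfderiv (𝓡 4) ψ x : TangentSpace (𝓡 4) x →ₗ[ℝ] ℝ)
        (mvfderiv (𝓡 4) u x : TangentSpace (𝓡 4) x →ₗ[ℝ] ℝ)]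
    ring
  -- integrability of the continuous integrands on the closed manifold
  have iA : Integrable (fun x ↦ 6 * g.gradSq (fun y ↦ ψ y * u y) x
      + g.scalarCurvature x * (ψ x * u x) ^ 2) g.riemVolume :=
    g.integrable_of_continuous ((continuous_const.mul hGc).add (hRc.mul ((hψc.mul huc).pow 2)))
  have iI : Integrable (fun x ↦ g.innerDual x
      (mvfderiv (𝓡 4) (fun y ↦ u y * u y * ψ y) x : TangentSpace (𝓡 4) x →ₗ[ℝ] ℝ)
      (mvfderiv (𝓡 4) ψ x : TangentSpace (𝓡 4) x →ₗ[ℝ] ℝ)) g.riemVolume :=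
    g.integrable_of_continuous hIc
  have iF : Integrable (fun x ↦ u x * u x * ψ x * g.dalembertian ψ x) g.riemVolume :=
    g.integrable_of_continuous (((huc.mul huc).mul hψc).mul hΔc)
  have iB : Integrable (fun x ↦ 6 * (g.innerDual x
      (mvfderiv (𝓡 4) (fun y ↦ u y * u y * ψ y) x : TangentSpace (𝓡 4) x →ₗ[ℝ] ℝ)
      (mvfderiv (𝓡 4) ψ x : TangentSpace (𝓡 4) x →ₗ[ℝ] ℝ)
        + u x * u x * ψ x * g.dalembertian ψ x)) g.riemVolume := (iI.add iF).const_mul 6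
  rw [hpt, integral_sub iA iB, integral_const_mul, integral_add iI iF, hGreen]
  ring

omit [T2Space M] in
/-- `Lᵖ` norms of continuous functions on the closed manifold are finite. -/
private theorem eLpNorm_ne_top_of_continuous {F : M → ℝ} (hF : Continuous F) (p : ℝ≥0∞) :
    eLpNorm F p g.riemVolume ≠ ⊤ := by
  haveI : IsFiniteMeasure g.riemVolume := ⟨g.riemVolume_univ_lt_top⟩
  obtain ⟨C, hC⟩ := (isCompact_range hF).isBounded.exists_norm_le
  exact (MemLp.of_bound hF.aestronglyMeasurable C (ae_of_all _ fun x ↦ hC _ ⟨x, rfl⟩)).eLpNorm_ne_top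

/-- `‖F‖²_{L⁴} = √(∫ F⁴)` for a continuous real function on the closed manifold. -/
private theorem toReal_eLpNorm_four_sq {F : M → ℝ} (hF : Continuous F) :
    (eLpNorm F 4 g.riemVolume).toReal ^ 2 = Real.sqrt (∫ x, F x ^ 4 ∂g.riemVolume) := by
  have hint : Integrable (fun x ↦ F x ^ 4) g.riemVolume := g.integrable_of_continuous (hF.pow 4)
  have hpt : ∀ x, (‖F x‖ₑ : ℝ≥0∞) ^ (4 : ℝ) = ENNReal.ofReal (F x ^ 4) := fun x ↦ by
    rw [← ofReal_norm, Real.norm_eq_abs, ENNReal.ofReal_rpow_of_nonneg (abs_nonneg _) (by norm_num),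
      show (4 : ℝ) = ((4 : ℕ) : ℝ) by norm_num, Real.rpow_natCast, Even.pow_abs ⟨2, rfl⟩]
  rw [eLpNorm_eq_lintegral_rpow_enorm_toReal (by norm_num) ENNReal.ofNat_ne_top,
    ENNReal.toReal_ofNat, ← ENNReal.toReal_rpow,
    integral_eq_lintegral_of_nonneg_ae (ae_of_all _ fun x ↦ by positivity) hint.aestronglyMeasurable]
  simp_rw [hpt]
  rw [Real.sqrt_eq_rpow, ← Real.rpow_natCast _ 2, ← Real.rpow_mul ENNReal.toReal_nonneg]
  norm_num

/-- **The Sobolev inequality of the closed `4`-manifold, squared and in real form**: there are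
`A, B ≥ 0` with `(∫ v⁴ dV)^{1/2} ≤ A ∫ |∇v|² dV + B ∫ v² dV` for every smooth `v`
(`exists_sobolev_const` with `n = 4`, `p = 2`, `p* = 4`: `‖v‖₄ ≤ A₀‖∇v‖₂ + B₀‖v‖₂`, squared with
`(a + b)² ≤ 2a² + 2b²`). Hebey 1999, Thm. 2.6. -/
private theorem exists_sobolev_sq (hg : g.IsRiemannian) :
    ∃ A B : ℝ, 0 ≤ A ∧ 0 ≤ B ∧ ∀ v : M → ℝ, ContMDiff (𝓡 4) 𝓘(ℝ, ℝ) ∞ v →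
      Real.sqrt (∫ x, v x ^ 4 ∂g.riemVolume) ≤
        A * ∫ x, g.gradSq v x ∂g.riemVolume + B * ∫ x, v x ^ 2 ∂g.riemVolume := by
  obtain ⟨A, B, hS⟩ := exists_sobolev_const g hg (p := 2) (p' := 4) (by norm_num)
    (by rw [finrank_euclideanSpace_fin]; norm_num) (by rw [finrank_euclideanSpace_fin]; norm_num)
  refine ⟨2 * (A : ℝ) ^ 2, 2 * (B : ℝ) ^ 2, by positivity, by positivity, fun v hv ↦ ?_⟩
  have hv1 : ContMDiff (𝓡 4) 𝓘(ℝ, ℝ) 1 v := hv.of_le (by norm_num)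
  have hvc : Continuous v := hv.continuous
  have hGc : Continuous (g.gradSq v) := (contMDiff_gradSq g hv).continuous
  have hGnn : ∀ x, 0 ≤ g.gradSq v x := fun x ↦ g.innerDual_self_nonneg hg x _
  have hX0 : 0 ≤ ∫ x, g.gradSq v x ∂g.riemVolume := integral_nonneg hGnn
  have hV0 : 0 ≤ ∫ x, v x ^ 2 ∂g.riemVolume := integral_nonneg fun x ↦ sq_nonneg _
  have hSv := hS v hv1
  rw [show ((2 : ℝ≥0) : ℝ≥0∞) = (2 : ℝ≥0∞) from rfl,
    show ((4 : ℝ≥0) : ℝ≥0∞) = (4 : ℝ≥0∞) from rfl] at hSv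
  have hA : (A : ℝ≥0∞) * eLpNorm (fun x ↦ Real.sqrt (g.gradSq v x)) 2 g.riemVolume ≠ ⊤ :=
    ENNReal.mul_ne_top ENNReal.coe_ne_top (eLpNorm_ne_top_of_continuous g hGc.sqrt 2)
  have hB : (B : ℝ≥0∞) * eLpNorm v 2 g.riemVolume ≠ ⊤ :=
    ENNReal.mul_ne_top ENNReal.coe_ne_top (eLpNorm_ne_top_of_continuous g hvc 2)
  have h := ENNReal.toReal_mono (ENNReal.add_ne_top.2 ⟨hA, hB⟩) hSv
  rw [ENNReal.toReal_add hA hB, ENNReal.toReal_mul, ENNReal.toReal_mul, ENNReal.coe_toReal,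
    ENNReal.coe_toReal, toReal_eLpNorm_two_eq_sqrt g hGc.sqrt, toReal_eLpNorm_two_eq_sqrt g hvc,
    integral_congr_ae (ae_of_all _ fun x ↦ Real.sq_sqrt (hGnn x))] at h
  -- `h : ‖v‖₄ ≤ A √X + B √V`
  rw [← toReal_eLpNorm_four_sq g hvc]
  have hN : 0 ≤ (eLpNorm v 4 g.riemVolume).toReal := ENNReal.toReal_nonneg
  calc (eLpNorm v 4 g.riemVolume).toReal ^ 2
      ≤ (A * Real.sqrt (∫ x, g.gradSq v x ∂g.riemVolume)
          + B * Real.sqrt (∫ x, v x ^ 2 ∂g.riemVolume)) ^ 2 := pow_le_pow_left₀ hN h 2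
    _ ≤ 2 * (A : ℝ) ^ 2 * Real.sqrt (∫ x, g.gradSq v x ∂g.riemVolume) ^ 2
          + 2 * (B : ℝ) ^ 2 * Real.sqrt (∫ x, v x ^ 2 ∂g.riemVolume) ^ 2 := by
        nlinarith [sq_nonneg ((A : ℝ) * Real.sqrt (∫ x, g.gradSq v x ∂g.riemVolume)
          - B * Real.sqrt (∫ x, v x ^ 2 ∂g.riemVolume))]
    _ = _ := by rw [Real.sq_sqrt hX0, Real.sq_sqrt hV0]

/-! ### The ground-state covariance and the estimate -/


/-- **Covariance of the Yamabe energy under the ground state.** If `L_g u₀ = R u₀ − 6 Δu₀ = 1`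
and `u₀ w = ψ u` (all smooth) then
`∫ (6 ψ² |∇u|² + ψ (R ψ − 6 Δψ) u²) dV = ∫ (6 u₀² |∇w|² + u₀ w²) dV`:
both sides equal `∫ (6 |∇(ψu)|² + R (ψu)²) dV` by the conformal invariance of the Yamabe energy
(`integral_conformal_eq`). Lee–Parker 1987, §3. [folklore] -/
theorem integral_eq_groundState [g.HasLeviCivita] (hg : g.IsRiemannian) {u₀ : M → ℝ}
    (hu₀ : ContMDiff (𝓡 4) 𝓘(ℝ, ℝ) ∞ u₀)
    (hL : ∀ x, g.scalarCurvature x * u₀ x - 6 * g.dalembertian u₀ x = 1) {ψ u w : M → ℝ}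
    (hψ : ContMDiff (𝓡 4) 𝓘(ℝ, ℝ) ∞ ψ) (hu : ContMDiff (𝓡 4) 𝓘(ℝ, ℝ) ∞ u)
    (hw : ContMDiff (𝓡 4) 𝓘(ℝ, ℝ) ∞ w) (hpt : ∀ y, u₀ y * w y = ψ y * u y) :
    ∫ x, (6 * (ψ x ^ 2 * g.gradSq u x)
        + ψ x * (g.scalarCurvature x * ψ x - 6 * g.dalembertian ψ x) * u x ^ 2) ∂g.riemVolume =
      ∫ x, (6 * (u₀ x ^ 2 * g.gradSq w x) + u₀ x * w x ^ 2) ∂g.riemVolume := by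
  have hfun : (fun y ↦ u₀ y * w y) = fun y ↦ ψ y * u y := funext hpt
  calc ∫ x, (6 * (ψ x ^ 2 * g.gradSq u x)
        + ψ x * (g.scalarCurvature x * ψ x - 6 * g.dalembertian ψ x) * u x ^ 2) ∂g.riemVolume
      = ∫ x, (6 * g.gradSq (fun y ↦ ψ y * u y) x + g.scalarCurvature x * (ψ x * u x) ^ 2)
          ∂g.riemVolume := integral_conformal_eq g hg hψ hu
    _ = ∫ x, (6 * g.gradSq (fun y ↦ u₀ y * w y) x + g.scalarCurvature x * (u₀ x * w x) ^ 2)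
          ∂g.riemVolume := by
        rw [hfun]
        simp only [hpt]
    _ = ∫ x, (6 * (u₀ x ^ 2 * g.gradSq w x)
          + u₀ x * (g.scalarCurvature x * u₀ x - 6 * g.dalembertian u₀ x) * w x ^ 2)
          ∂g.riemVolume := (integral_conformal_eq g hg hu₀ hw).symm
    _ = ∫ x, (6 * (u₀ x ^ 2 * g.gradSq w x) + u₀ x * w x ^ 2) ∂g.riemVolume :=
        integral_congr_ae (ae_of_all _ fun x ↦ by dsimp only; rw [hL x]; ring)

/-- **The ground-state estimate.** If `0 < c ≤ u₀ ≤ C`, `(∫ v⁴)^{1/2} ≤ A ∫|∇v|² + B ∫ v²` is the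
squared Sobolev inequality of the closed manifold, and `w` is smooth, then
`k/(C²(A+B)+1) · (∫ u₀⁴ w⁴ dV)^{1/2} ≤ ∫ (6 u₀² |∇w|² + u₀ w²) dV` with `k = min(6c², c)`:
the left side is `≤ C² (∫ w⁴)^{1/2} ≤ C² (A ∫|∇w|² + B ∫ w²)`, the right side is
`≥ 6c² ∫|∇w|² + c ∫ w²`. [folklore] -/
theorem groundState_estimate (hg : g.IsRiemannian) {u₀ : M → ℝ} (hu₀c : Continuous u₀)
    {c C A B : ℝ} (hc : 0 < c) (hb : ∀ x, c ≤ u₀ x ∧ u₀ x ≤ C) (hA : 0 ≤ A) (hB : 0 ≤ B)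
    (hS : ∀ v : M → ℝ, ContMDiff (𝓡 4) 𝓘(ℝ, ℝ) ∞ v →
      Real.sqrt (∫ x, v x ^ 4 ∂g.riemVolume) ≤
        A * ∫ x, g.gradSq v x ∂g.riemVolume + B * ∫ x, v x ^ 2 ∂g.riemVolume)
    {w : M → ℝ} (hw : ContMDiff (𝓡 4) 𝓘(ℝ, ℝ) ∞ w) :
    min (6 * c ^ 2) c / (C ^ 2 * (A + B) + 1) *
        Real.sqrt (∫ x, u₀ x ^ 4 * w x ^ 4 ∂g.riemVolume) ≤
      ∫ x, (6 * (u₀ x ^ 2 * g.gradSq w x) + u₀ x * w x ^ 2) ∂g.riemVolume := by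
  have hwc : Continuous w := hw.continuous
  have hGc : Continuous (g.gradSq w) := (contMDiff_gradSq g hw).continuous
  have hGnn : ∀ x, 0 ≤ g.gradSq w x := fun x ↦ g.innerDual_self_nonneg hg x _
  have hX0 : 0 ≤ ∫ x, g.gradSq w x ∂g.riemVolume := integral_nonneg hGnn
  have hV0 : 0 ≤ ∫ x, w x ^ 2 ∂g.riemVolume := integral_nonneg fun x ↦ sq_nonneg _
  -- the left side: `∫ u₀⁴ w⁴ ≤ C⁴ ∫ w⁴`, hence `(∫ u₀⁴ w⁴)^{1/2} ≤ C² (A X + B V)`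
  have i4 : Integrable (fun x ↦ u₀ x ^ 4 * w x ^ 4) g.riemVolume :=
    g.integrable_of_continuous ((hu₀c.pow 4).mul (hwc.pow 4))
  have i5 : Integrable (fun x ↦ C ^ 4 * w x ^ 4) g.riemVolume :=
    (g.integrable_of_continuous (hwc.pow 4)).const_mul _
  have hL4 : ∫ x, u₀ x ^ 4 * w x ^ 4 ∂g.riemVolume ≤ C ^ 4 * ∫ x, w x ^ 4 ∂g.riemVolume := by
    rw [← integral_const_mul]
    exact integral_mono i4 i5 fun x ↦ mul_le_mul_of_nonneg_right
      (pow_le_pow_left₀ (hc.le.trans (hb x).1) (hb x).2 4) (by positivity)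
  have hS' : Real.sqrt (∫ x, u₀ x ^ 4 * w x ^ 4 ∂g.riemVolume) ≤
      C ^ 2 * (A * ∫ x, g.gradSq w x ∂g.riemVolume + B * ∫ x, w x ^ 2 ∂g.riemVolume) := by
    calc Real.sqrt (∫ x, u₀ x ^ 4 * w x ^ 4 ∂g.riemVolume)
        ≤ Real.sqrt (C ^ 4 * ∫ x, w x ^ 4 ∂g.riemVolume) := Real.sqrt_le_sqrt hL4
      _ = C ^ 2 * Real.sqrt (∫ x, w x ^ 4 ∂g.riemVolume) := by
          rw [Real.sqrt_mul (by positivity), show C ^ 4 = (C ^ 2) ^ 2 by ring,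
            Real.sqrt_sq (by positivity)]
      _ ≤ _ := mul_le_mul_of_nonneg_left (hS w hw) (by positivity)
  -- the right side: `6c² X + c V ≤ ∫ (6 u₀² |∇w|² + u₀ w²)`
  have i1 : Integrable (fun x ↦ 6 * c ^ 2 * g.gradSq w x) g.riemVolume :=
    (g.integrable_of_continuous hGc).const_mul _
  have i2 : Integrable (fun x ↦ c * w x ^ 2) g.riemVolume :=
    (g.integrable_of_continuous (hwc.pow 2)).const_mul _
  have i3 : Integrable (fun x ↦ 6 * (u₀ x ^ 2 * g.gradSq w x) + u₀ x * w x ^ 2) g.riemVolume :=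
    g.integrable_of_continuous
      ((continuous_const.mul ((hu₀c.pow 2).mul hGc)).add (hu₀c.mul (hwc.pow 2)))
  have hR' : 6 * c ^ 2 * (∫ x, g.gradSq w x ∂g.riemVolume) + c * (∫ x, w x ^ 2 ∂g.riemVolume) ≤
      ∫ x, (6 * (u₀ x ^ 2 * g.gradSq w x) + u₀ x * w x ^ 2) ∂g.riemVolume := by
    rw [← integral_const_mul, ← integral_const_mul, ← integral_add i1 i2]
    refine integral_mono (i1.add i2) i3 fun x ↦ ?_
    have h1 : c ^ 2 * g.gradSq w x ≤ u₀ x ^ 2 * g.gradSq w x :=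
      mul_le_mul_of_nonneg_right (pow_le_pow_left₀ hc.le (hb x).1 2) (hGnn x)
    have h2 : c * w x ^ 2 ≤ u₀ x * w x ^ 2 := mul_le_mul_of_nonneg_right (hb x).1 (sq_nonneg _)
    linarith
  have hk : 0 < min (6 * c ^ 2) c := lt_min (by positivity) hc
  exact assembly_arith (min_le_right _ _) (min_le_left _ _) hk.le hA hB hX0 hV0 hS' hR'

/-- **The Yamabe–Sobolev inequality of a conformal class with positively invertible conformal
Laplacian** (volume measure `g.riemVolume`): if `u₀ > 0` is smooth with `R u₀ − 6 Δ u₀ = 1` there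
is `Y > 0` with `Y (∫ u⁴ψ⁴ dV)^{1/2} ≤ ∫ (6ψ²|∇u|² + ψ(Rψ − 6Δψ)u²) dV` for all smooth `ψ > 0`
and smooth `u` (`integral_eq_groundState` with `w = ψu/u₀`, then `groundState_estimate`).
Lee–Parker 1987, §3; Hebey 1999, Thm. 2.6. [folklore] -/
theorem yamabeSobolev_groundState_riemVolume [g.HasLeviCivita] (hg : g.IsRiemannian)
    {u₀ : M → ℝ} (hu₀ : ContMDiff (𝓡 4) 𝓘(ℝ, ℝ) ∞ u₀) (hu₀pos : ∀ x, 0 < u₀ x)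
    (hL : ∀ x, g.scalarCurvature x * u₀ x - 6 * g.dalembertian u₀ x = 1) :
    ∃ Y : ℝ, 0 < Y ∧ ∀ (ψ : M → ℝ), ContMDiff (𝓡 4) 𝓘(ℝ, ℝ) ∞ ψ → (∀ x, 0 < ψ x) →
      ∀ (u : M → ℝ), ContMDiff (𝓡 4) 𝓘(ℝ, ℝ) ∞ u →
        Y * Real.sqrt (∫ x, u x ^ 4 * ψ x ^ 4 ∂g.riemVolume) ≤
          ∫ x, (6 * (ψ x ^ 2 * g.gradSq u x)
            + ψ x * (g.scalarCurvature x * ψ x - 6 * g.dalembertian ψ x) * u x ^ 2)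
            ∂g.riemVolume := by
  obtain ⟨c, C, hc, -, hb⟩ := exists_pos_bounds hu₀.continuous hu₀pos
  obtain ⟨A, B, hA, hB, hS⟩ := exists_sobolev_sq g hg
  refine ⟨min (6 * c ^ 2) c / (C ^ 2 * (A + B) + 1),
    div_pos (lt_min (by positivity) hc) (by positivity), fun ψ hψ _ u hu ↦ ?_⟩
  have hu₀ne : ∀ x, u₀ x ≠ 0 := fun x ↦ (hu₀pos x).ne'
  -- `w = ψ u / u₀`
  have hw : ContMDiff (𝓡 4) 𝓘(ℝ, ℝ) ∞ (fun y ↦ (u₀ y)⁻¹ * (ψ y * u y)) :=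
    (hu₀.inv₀ hu₀ne).mul (hψ.mul hu)
  have hpt : ∀ y, u₀ y * ((u₀ y)⁻¹ * (ψ y * u y)) = ψ y * u y := fun y ↦
    mul_inv_cancel_left₀ (hu₀ne y) _
  have hlhs : ∫ x, u x ^ 4 * ψ x ^ 4 ∂g.riemVolume =
      ∫ x, u₀ x ^ 4 * ((u₀ x)⁻¹ * (ψ x * u x)) ^ 4 ∂g.riemVolume :=
    integral_congr_ae (ae_of_all _ fun x ↦ by
      dsimp only
      rw [← mul_pow (u₀ x), hpt x]
      ring)
  rw [integral_eq_groundState g hg hu₀ hL hψ hu hw hpt, hlhs]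
  exact groundState_estimate g hg hu₀.continuous hc hb hA hB hS hw

end YamabeSobolevOfNonneg

/-- **Stub S4 of line `green-blowup-conformal-entropy` — the Yamabe–Sobolev inequality of a
conformal class with positively invertible conformal Laplacian, registered form** (summit binder,
explicit arguments; see `YamabeSobolevOfNonneg.yamabeSobolev_groundState_riemVolume`). If the
closed `4`-manifold carries a smooth `u₀ > 0` with `R_g u₀ − 6 Δ_g u₀ = 1` (e.g. `R_g ≥ 0` not
identically zero, Schoen's flat gauge) there is `Y > 0` such that for every smooth `ψ > 0` and
smooth `u`, `Y (∫ u⁴ψ⁴ dV_g)^{1/2} ≤ ∫ (6ψ²|∇u|²_g + ψ(R_g ψ − 6Δ_g ψ) u²) dV_g`, i.e.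
`Y ‖u‖²_{L⁴(ĝ)} ≤ ∫ (6|∇u|²_ĝ + R_ĝ u²) dV_ĝ` for every `ĝ = ψ²g` of the class with one `Y`
(covariance of the Yamabe energy under `u₀`, `E(u₀ w) = ∫ (6u₀²|∇w|² + u₀ w²)`, plus the Sobolev
inequality of `(M, g)`). Lee–Parker 1987, §3; Hebey 1999, Thm. 2.6; Schoen 1984, §1. Helper for
stub `stub_conformalGluing` (crux stmt-SmoothPoincare4-10871). [folklore] -/
theorem stub_yamabeSobolevOfNonneg :
    ∀ (M : Type) [TopologicalSpace M] [T2Space M] [SecondCountableTopology M]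
      [ChartedSpace (EuclideanSpace ℝ (Fin 4)) M] [IsManifold (𝓡 4) ∞ M] [CompactSpace M]
      [T3Space M] [MeasurableSpace M] [BorelSpace M]
      (g : PseudoRiemannianMetric (𝓡 4) ∞ (EuclideanSpace ℝ (Fin 4)) (TangentSpace (𝓡 4) : M → Type _))
      [g.HasLeviCivita] (hg : g.IsRiemannian),
      (∃ u₀ : M → ℝ, ContMDiff (𝓡 4) 𝓘(ℝ, ℝ) ∞ u₀ ∧ (∀ x, 0 < u₀ x) ∧
        ∀ x, g.scalarCurvature x * u₀ x - 6 * g.dalembertian u₀ x = 1) →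
      ∃ Y : ℝ, 0 < Y ∧ ∀ (ψ : M → ℝ), ContMDiff (𝓡 4) 𝓘(ℝ, ℝ) ∞ ψ → (∀ x, 0 < ψ x) →
        ∀ (u : M → ℝ), ContMDiff (𝓡 4) 𝓘(ℝ, ℝ) ∞ u →
          Y * Real.sqrt (∫ x, u x ^ 4 * ψ x ^ 4 ∂(riemannianMeasure (g.toContMDiffRiemannianMetric hg))) ≤
            ∫ x, (6 * (ψ x ^ 2 * g.gradSq u x)
                + ψ x * (g.scalarCurvature x * ψ x - 6 * g.dalembertian ψ x) * u x ^ 2)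
              ∂(riemannianMeasure (g.toContMDiffRiemannianMetric hg)) := by
  intro M _ _ _ _ _ _ _ _ _ g _ hg hu₀
  obtain ⟨u₀, hu₀, hu₀pos, hL⟩ := hu₀
  rw [← PseudoRiemannianMetric.riemVolume_eq hg]
  exact YamabeSobolevOfNonneg.yamabeSobolev_groundState_riemVolume g hg hu₀ hu₀pos hL

end Summit.SmoothPoincare4.SmoothPoincare4.Theorems

end
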